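import Summits.QuantumFields.YangMills.Theorems.DressedRitz.Negative.LeakageMixtureHazard
import Summits.QuantumFields.YangMills.Theorems.LuscherReductionDressedRitzPolyakovLiftStaticsDressedSymmetry
import Summits.QuantumFields.YangMills.Theorems.LuscherReductionDressedRitzPolyakovLiftEuclideanCurrencyClauses
import HarnessLib

/-!
# Route `LuscherReduction`, crux `DressedRitz` (stmt-QuantumFields-20205), line «polyakovlift» r5 — NEGATIVE lane:
# time-dressing is NOT a projector on the low tower — the dressed two-level model of (o4) and (o5), and the log-convexity floor of (o4)

Negative-side support lemmas of the standing disprover (seat `ym-cdisprove-20205-1`, GEN 3; work file `Cruxes/DressedRitz/Disproof.lean` §7).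
Nothing here asserts a route item; nothing here refutes one.  Skeleton of record r5 `8b6782afbcc2a19a`: every stub reads the TIME-DRESSED family
`u_i = K_β^[m](ins φ G_i)`, `m = dressSteps L = L` (reshape r3, after the one-loop UV hazard of the sharp-time lift), and the lead's Euclidean
dictionary (`…PolyakovLiftEuclideanCurrency[Clauses].lean`, p537143 ∕ p538974) reads every clause as a statement about the normalised connected
correlators `corr_t`, `t ∈ {2m, 2m+1, 2m+2}`.  This file is the r3∕r5 twin of g0's `LeakageMixtureHazard.lean` (the case `m = 0`, `s = 1` below) and
records, kernel-checked, what the dressing does and does not do.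

* §1 TWO-LEVEL ALGEBRA.  For `l2`-orthonormal physical exact eigenvectors `ψ₁, ψ₂` of `K_β` (eigenvalues `κ₁, κ₂`) and a leakage amplitude `s`,
  the dressed mixture `v_m = K_β^[m](ψ₁ + s•ψ₂) = κ₁^m•ψ₁ + (sκ₂^m)•ψ₂` (`iterate_transferApply_mixture`) has
  `‖v_m‖² = κ₁^{2m} + s²κ₂^{2m}`, `⟨v_m, K v_m⟩ = κ₁^{2m+1} + s²κ₂^{2m+1}`, `‖K v_m‖² = κ₁^{2m+2} + s²κ₂^{2m+2}`, hence
  LEAKAGE DEFECT `‖Kv‖²‖v‖² − ⟨v,Kv⟩² = s²(κ₁κ₂)^{2m}(κ₁ − κ₂)²` (`leakage_defect_of_dressedMixture`) and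
  RITZ DEFICIT `κ₁‖v‖² − ⟨v,Kv⟩ = s²κ₂^{2m}(κ₁ − κ₂)` (`ritz_deficit_of_dressedMixture`).
* §2 (o4) ON THE DRESSED MIXTURE.  `LeakageClause 1 C β (fun _ ↦ v_m) ↔ s²(κ₁κ₂)^{2m}(κ₁−κ₂)² ≤ C(Λ³/L²)λ₀²(κ₁^{2m} + s²κ₂^{2m})²`
  (`leakageClause_dressedMixture_iff`, `not_leakageClause_of_dressedMixture`).  READING (`r = κ₂/κ₁`, dressed leakage weight
  `δ_m = s²r^{2m}/(1 + s²r^{2m})`): violated iff `δ_m(1−δ_m)(1−r)²κ₁² > C(Λ³/L²)λ₀²`.  For two members of the LOW TOWER (`1 − r ≍ Δε·Λ/L`) and the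
  registered depth `m = L`, `r^{2L} = e^{−2ΔεΛ}(1+o(1))` is `O(1)`: the dressing re-weights tower members by bounded factors and does NOT remove an
  `O(1)` inter-shell admixture — g0's `∀`-basis hazard (T2) stands VERBATIM for the dressed family (its discharge is still ONE's non-crossing,
  `oneSite_levels_ne_at_liftCoupling`, plus Schur inside irreducible `O_h`-multiplets, `DoubletRotationVoid.lean`); for a HARD admixture (`1 − r = O(1)`,
  i.e. `r^{2L} = e^{−O(L)}`) the clause holds as soon as `s²e^{−O(L)} ≤ CΛ³/L²` — exactly the cure the dressing was introduced for (lead's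
  `HAZARD-S-LEAK-UV.md`, evidence #27).  Located bookkeeping, not a defect of the line.
* §3 (o5) ON THE DRESSED MIXTURE — NEAR IS NECESSARY.  If the channel's dominant fine level sits EXACTLY at the one-site ratio
  (`μ₁(B)·λ₀ = κ₁·μ₀(B)`, perfect level universality), the lower (o5) inequality for the singleton family `v_m` FAILS as soon as
  `e^{CΛ²/L}·s²κ₂^{2m}(κ₁−κ₂) > (e^{CΛ²/L} − 1)·κ₁(κ₁^{2m} + s²κ₂^{2m})`, i.e. `δ_m·(1 − r) > 1 − e^{−CΛ²/L} ≈ CΛ²/L`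
  (`not_dynamicCoreClauses_of_dressedMixture`): at tolerance `Λ²/L` against a tower gap `(1−r) ≍ ΔεΛ/L` the dressed leakage weight must be
  `δ_L ≲ CΛ/Δε` — the NEAR content of the lead's BLUEPRINT-S-UNIV §4, kernel form.  One-loop eigenvector corrections give `δ = O(λ²)` (one power
  spare), so (o5)∕(A5) do not over-ask; they DO ask for single-level concentration of the flowed-Polyakov channel vectors, not only for level positions.
* §4 THE LOG-CONVEXITY FLOOR.  For every physical `u`: `0 ≤ ‖K_βu‖²‖u‖² − ⟨u,K_βu⟩²` (`leakage_defect_nonneg`, Cauchy–Schwarz), and in Euclidean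
  currency `0 ≤ corr_{2m+2,ii}·corr_{2m,ii} − corr_{2m+1,ii}²` for every insertion family (`corr_logConvexity_nonneg`): the S-LEAK target is
  ONE-SIDED (`0 ≤ D_{2m} ≤ C(λ³/L²)corr_{2m}²`; the effective mass is non-increasing between separations `2m → 2m+1 → 2m+2`), `C < 0` is impossible
  on a non-null channel (`not_leakageClause_of_neg`), and `D = 0` exactly on eigen-dominated channels (g1 `leakageClause_of_eigenfamily`, `s = 0` here).

HONEST FRAMING: fixed-lattice linear algebra about the hypotheses of stubs of a child of the CONDITIONAL reduction route R2b1; no stub is closed or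
refuted; nothing here bears on infinite volume, the continuum limit or the Clay mass gap.
References: M. Lüscher, U. Wolff, NPB 339 (1990) 222 [cite: LuscherWolff1990]; M. Lüscher, NPB 219 (1983) 233 [cite: Luscher1983, §3].
-/

set_option autoImplicit false

noncomputable section

open MeasureTheory Filter Topology Real
open Literature.MathematicalPhysics.QuantumFieldTheory (GaugeConfig Site gaugeTransform)
open scoped BigOperators

namespace Summit.QuantumFields.YangMills.Theorems.FemtoTransferGap.PolyakovLift.Negative

open Summit.QuantumFields.YangMills.Theorems.FemtoTransferGap
open Summit.QuantumFields.YangMills.Theorems.FemtoTransferGap.PolyakovLift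

/-! ## §1 Two-level algebra: the dressed mixture of two exact eigenvectors -/

section TwoLevel

variable {L : ℕ} [NeZero L] (β : ℝ) {ψ₁ ψ₂ : GaugeConfig 3 L SU2 → ℝ} {κ₁ κ₂ : ℝ}

/-- Bilinear pairing of two two-component vectors over an orthonormal physical pair: `⟨aψ₁ + bψ₂, cψ₁ + dψ₂⟩ = ac + bd`. [folklore] -/
theorem l2_twoLevel_pair (h₁ : IsPhys ψ₁) (h₂ : IsPhys ψ₂) (hn₁ : l2 ψ₁ ψ₁ = 1) (hn₂ : l2 ψ₂ ψ₂ = 1)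
    (h₁₂ : l2 ψ₁ ψ₂ = 0) (a b c d : ℝ) :
    l2 (a • ψ₁ + b • ψ₂) (c • ψ₁ + d • ψ₂) = a * c + b * d := by
  have h₂₁ : l2 ψ₂ ψ₁ = 0 := by rw [l2_comm]; exact h₁₂
  have ha := h₁.smul a
  have hb := h₂.smul b
  have hc := h₁.smul c
  have hd := h₂.smul d
  rw [l2_add_left ha hb (hc.add hd), l2_add_right ha hc hd, l2_add_right hb hc hd,
    l2_smul_left, l2_smul_left, l2_smul_left, l2_smul_left,
    l2_smul_right'', l2_smul_right'', l2_smul_right'', l2_smul_right'', hn₁, hn₂, h₁₂, h₂₁]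
  ring

/-- `K_β(aψ₁ + bψ₂) = (aκ₁)ψ₁ + (bκ₂)ψ₂` for exact eigenvectors. [folklore] -/
theorem transferApply_twoLevel (h₁ : IsPhys ψ₁) (h₂ : IsPhys ψ₂)
    (he₁ : transferApply β ψ₁ = κ₁ • ψ₁) (he₂ : transferApply β ψ₂ = κ₂ • ψ₂) (a b : ℝ) :
    transferApply β (a • ψ₁ + b • ψ₂) = (a * κ₁) • ψ₁ + (b * κ₂) • ψ₂ := by
  rw [transferApply_add β (h₁.smul a) (h₂.smul b), transferApply_smul, transferApply_smul, he₁, he₂, smul_smul, smul_smul]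

/-- Iterates of the transfer operator on an exact eigenvector: `K_β^[m] ψ = κ^m • ψ`. [folklore] -/
theorem iterate_transferApply_eigen {ψ : GaugeConfig 3 L SU2 → ℝ} {κ : ℝ} (he : transferApply β ψ = κ • ψ) :
    ∀ m : ℕ, (transferApply (L := L) β)^[m] ψ = κ ^ m • ψ
  | 0 => by simp
  | m + 1 => by
    rw [Function.iterate_succ_apply', iterate_transferApply_eigen he m, transferApply_smul, he, smul_smul, pow_succ]

/-- **The dressed mixture**: `K_β^[m](ψ₁ + s•ψ₂) = κ₁^m•ψ₁ + (sκ₂^m)•ψ₂`. [folklore] -/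
theorem iterate_transferApply_mixture (h₁ : IsPhys ψ₁) (h₂ : IsPhys ψ₂)
    (he₁ : transferApply β ψ₁ = κ₁ • ψ₁) (he₂ : transferApply β ψ₂ = κ₂ • ψ₂) (s : ℝ) (m : ℕ) :
    (transferApply (L := L) β)^[m] (ψ₁ + s • ψ₂) = (κ₁ ^ m) • ψ₁ + (s * κ₂ ^ m) • ψ₂ := by
  have h1 : ψ₁ + s • ψ₂ = (1 : ℝ) • ψ₁ + s • ψ₂ := by rw [one_smul]
  rw [h1, iterate_transferApply_lincomb β h₁ h₂ 1 s m, iterate_transferApply_eigen β he₁ m, iterate_transferApply_eigen β he₂ m,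
    smul_smul, smul_smul, one_mul]

/-- Gram number of the dressed mixture: `‖v_m‖² = κ₁^{2m} + s²κ₂^{2m}`. [folklore] -/
theorem l2_dressedMixture_self (h₁ : IsPhys ψ₁) (h₂ : IsPhys ψ₂)
    (he₁ : transferApply β ψ₁ = κ₁ • ψ₁) (he₂ : transferApply β ψ₂ = κ₂ • ψ₂)
    (hn₁ : l2 ψ₁ ψ₁ = 1) (hn₂ : l2 ψ₂ ψ₂ = 1) (h₁₂ : l2 ψ₁ ψ₂ = 0) (s : ℝ) (m : ℕ) :
    l2 ((transferApply (L := L) β)^[m] (ψ₁ + s • ψ₂)) ((transferApply β)^[m] (ψ₁ + s • ψ₂)) =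
      κ₁ ^ (2 * m) + s ^ 2 * κ₂ ^ (2 * m) := by
  rw [iterate_transferApply_mixture β h₁ h₂ he₁ he₂ s m, l2_twoLevel_pair h₁ h₂ hn₁ hn₂ h₁₂]
  ring

/-- Form number of the dressed mixture: `⟨v_m, K v_m⟩ = κ₁^{2m+1} + s²κ₂^{2m+1}`. [folklore] -/
theorem l2_dressedMixture_transferApply (h₁ : IsPhys ψ₁) (h₂ : IsPhys ψ₂)
    (he₁ : transferApply β ψ₁ = κ₁ • ψ₁) (he₂ : transferApply β ψ₂ = κ₂ • ψ₂)
    (hn₁ : l2 ψ₁ ψ₁ = 1) (hn₂ : l2 ψ₂ ψ₂ = 1) (h₁₂ : l2 ψ₁ ψ₂ = 0) (s : ℝ) (m : ℕ) :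
    l2 ((transferApply (L := L) β)^[m] (ψ₁ + s • ψ₂)) (transferApply β ((transferApply β)^[m] (ψ₁ + s • ψ₂))) =
      κ₁ ^ (2 * m + 1) + s ^ 2 * κ₂ ^ (2 * m + 1) := by
  rw [iterate_transferApply_mixture β h₁ h₂ he₁ he₂ s m, transferApply_twoLevel β h₁ h₂ he₁ he₂,
    l2_twoLevel_pair h₁ h₂ hn₁ hn₂ h₁₂]
  ring

/-- Two-step Gram number of the dressed mixture: `‖K v_m‖² = κ₁^{2m+2} + s²κ₂^{2m+2}`. [folklore] -/
theorem l2_transferApply_dressedMixture_self (h₁ : IsPhys ψ₁) (h₂ : IsPhys ψ₂)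
    (he₁ : transferApply β ψ₁ = κ₁ • ψ₁) (he₂ : transferApply β ψ₂ = κ₂ • ψ₂)
    (hn₁ : l2 ψ₁ ψ₁ = 1) (hn₂ : l2 ψ₂ ψ₂ = 1) (h₁₂ : l2 ψ₁ ψ₂ = 0) (s : ℝ) (m : ℕ) :
    l2 (transferApply β ((transferApply (L := L) β)^[m] (ψ₁ + s • ψ₂)))
        (transferApply β ((transferApply β)^[m] (ψ₁ + s • ψ₂))) =
      κ₁ ^ (2 * m + 2) + s ^ 2 * κ₂ ^ (2 * m + 2) := by
  rw [iterate_transferApply_mixture β h₁ h₂ he₁ he₂ s m, transferApply_twoLevel β h₁ h₂ he₁ he₂,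
    l2_twoLevel_pair h₁ h₂ hn₁ hn₂ h₁₂]
  ring

/-- ★ **Leakage defect of the dressed mixture**: `‖Kv‖²‖v‖² − ⟨v,Kv⟩² = s²(κ₁κ₂)^{2m}(κ₁ − κ₂)²` for `v = K_β^[m](ψ₁ + s•ψ₂)` — the dressing
multiplies g0's defect `(κ₁ − κ₂)²` by the RELATIVE weight `(κ₁κ₂)^{2m}`, i.e. by `r^{2m}` in units of `‖v‖⁴ ≍ κ₁^{4m}` (`r = κ₂/κ₁`). [cite: LuscherWolff1990] -/
theorem leakage_defect_of_dressedMixture (h₁ : IsPhys ψ₁) (h₂ : IsPhys ψ₂)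
    (he₁ : transferApply β ψ₁ = κ₁ • ψ₁) (he₂ : transferApply β ψ₂ = κ₂ • ψ₂)
    (hn₁ : l2 ψ₁ ψ₁ = 1) (hn₂ : l2 ψ₂ ψ₂ = 1) (h₁₂ : l2 ψ₁ ψ₂ = 0) (s : ℝ) (m : ℕ) :
    l2 (transferApply β ((transferApply (L := L) β)^[m] (ψ₁ + s • ψ₂)))
          (transferApply β ((transferApply β)^[m] (ψ₁ + s • ψ₂))) *
        l2 ((transferApply β)^[m] (ψ₁ + s • ψ₂)) ((transferApply β)^[m] (ψ₁ + s • ψ₂)) -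
      l2 ((transferApply β)^[m] (ψ₁ + s • ψ₂)) (transferApply β ((transferApply β)^[m] (ψ₁ + s • ψ₂))) ^ 2 =
      s ^ 2 * (κ₁ * κ₂) ^ (2 * m) * (κ₁ - κ₂) ^ 2 := by
  rw [l2_transferApply_dressedMixture_self β h₁ h₂ he₁ he₂ hn₁ hn₂ h₁₂, l2_dressedMixture_self β h₁ h₂ he₁ he₂ hn₁ hn₂ h₁₂,
    l2_dressedMixture_transferApply β h₁ h₂ he₁ he₂ hn₁ hn₂ h₁₂]
  ring

/-- ★ **Ritz deficit of the dressed mixture**: `κ₁‖v‖² − ⟨v,Kv⟩ = s²κ₂^{2m}(κ₁ − κ₂)` — the effective ratio of `v_m` sits BELOW the dominant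
level by the dressed leakage weight times the gap. [cite: LuscherWolff1990] -/
theorem ritz_deficit_of_dressedMixture (h₁ : IsPhys ψ₁) (h₂ : IsPhys ψ₂)
    (he₁ : transferApply β ψ₁ = κ₁ • ψ₁) (he₂ : transferApply β ψ₂ = κ₂ • ψ₂)
    (hn₁ : l2 ψ₁ ψ₁ = 1) (hn₂ : l2 ψ₂ ψ₂ = 1) (h₁₂ : l2 ψ₁ ψ₂ = 0) (s : ℝ) (m : ℕ) :
    κ₁ * l2 ((transferApply (L := L) β)^[m] (ψ₁ + s • ψ₂)) ((transferApply β)^[m] (ψ₁ + s • ψ₂)) -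
      l2 ((transferApply β)^[m] (ψ₁ + s • ψ₂)) (transferApply β ((transferApply β)^[m] (ψ₁ + s • ψ₂))) =
      s ^ 2 * κ₂ ^ (2 * m) * (κ₁ - κ₂) := by
  rw [l2_dressedMixture_self β h₁ h₂ he₁ he₂ hn₁ hn₂ h₁₂, l2_dressedMixture_transferApply β h₁ h₂ he₁ he₂ hn₁ hn₂ h₁₂]
  ring

/-! ## §2 Clause (o4) on the dressed mixture: the dressing is not a projector on the low tower -/

/-- ★ **(o4) for the singleton dressed-mixture family, in closed form**: `LeakageClause 1 C β (fun _ ↦ K_β^[m](ψ₁ + s•ψ₂))` ⟺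
`s²(κ₁κ₂)^{2m}(κ₁−κ₂)² ≤ C(Λ³/L²)λ₀²(κ₁^{2m} + s²κ₂^{2m})²`. [cite: LuscherWolff1990] -/
theorem leakageClause_dressedMixture_iff (C : ℝ) (h₁ : IsPhys ψ₁) (h₂ : IsPhys ψ₂)
    (he₁ : transferApply β ψ₁ = κ₁ • ψ₁) (he₂ : transferApply β ψ₂ = κ₂ • ψ₂)
    (hn₁ : l2 ψ₁ ψ₁ = 1) (hn₂ : l2 ψ₂ ψ₂ = 1) (h₁₂ : l2 ψ₁ ψ₂ = 0) (s : ℝ) (m : ℕ) :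
    LeakageClause 1 C β (fun _ => (transferApply (L := L) β)^[m] (ψ₁ + s • ψ₂)) ↔
      s ^ 2 * (κ₁ * κ₂) ^ (2 * m) * (κ₁ - κ₂) ^ 2 ≤
        C * (luscherLambda β L ^ 3 / (L : ℝ) ^ 2) * levelValue su2Rep L β 0 ^ 2 * (κ₁ ^ (2 * m) + s ^ 2 * κ₂ ^ (2 * m)) ^ 2 := by
  unfold LeakageClause
  rw [Fin.forall_fin_one]
  dsimp only
  rw [leakage_defect_of_dressedMixture β h₁ h₂ he₁ he₂ hn₁ hn₂ h₁₂, l2_dressedMixture_self β h₁ h₂ he₁ he₂ hn₁ hn₂ h₁₂]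

/-- ★ **What survives the dressing.**  `¬ LeakageClause 1 C β (fun _ ↦ K_β^[m](ψ₁ + s•ψ₂))` as soon as
`C(Λ³/L²)λ₀²(κ₁^{2m} + s²κ₂^{2m})² < s²(κ₁κ₂)^{2m}(κ₁−κ₂)²`; with `r = κ₂/κ₁`, `δ_m = s²r^{2m}/(1+s²r^{2m})`: iff `δ_m(1−δ_m)(1−r)²κ₁² > C(Λ³/L²)λ₀²`.
Low-tower pair at the registered depth `m = L`: `r^{2L} = e^{−2ΔεΛ}(1+o(1)) = O(1)`, `(1−r)² ≍ Δε²Λ²/L² ≫ CΛ³/L²` — violated exactly as for the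
undressed mixture (g0 `not_leakageClause_of_mixture` is the case `m = 0`, `s = 1`); hard pair: `r^{2L} = e^{−O(L)}` — cured. [cite: LuscherWolff1990] -/
theorem not_leakageClause_of_dressedMixture (C : ℝ) (h₁ : IsPhys ψ₁) (h₂ : IsPhys ψ₂)
    (he₁ : transferApply β ψ₁ = κ₁ • ψ₁) (he₂ : transferApply β ψ₂ = κ₂ • ψ₂)
    (hn₁ : l2 ψ₁ ψ₁ = 1) (hn₂ : l2 ψ₂ ψ₂ = 1) (h₁₂ : l2 ψ₁ ψ₂ = 0) (s : ℝ) (m : ℕ)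
    (hgap : C * (luscherLambda β L ^ 3 / (L : ℝ) ^ 2) * levelValue su2Rep L β 0 ^ 2 * (κ₁ ^ (2 * m) + s ^ 2 * κ₂ ^ (2 * m)) ^ 2 <
      s ^ 2 * (κ₁ * κ₂) ^ (2 * m) * (κ₁ - κ₂) ^ 2) :
    ¬ LeakageClause 1 C β (fun _ => (transferApply (L := L) β)^[m] (ψ₁ + s • ψ₂)) := by
  rw [leakageClause_dressedMixture_iff β C h₁ h₂ he₁ he₂ hn₁ hn₂ h₁₂ s m]
  exact not_le.mpr hgap

/-! ## §3 Clause (o5) on the dressed mixture: single-level concentration (NEAR) is necessary -/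

/-- ★ **(o5) forces NEAR.**  For the singleton family `v = K_β^[m](ψ₁ + s•ψ₂)` (level `0` of a `k = 1` family) whose dominant fine level sits
EXACTLY at the one-site ratio, `μ₁(B)·λ₀ = κ₁·μ₀(B)` (`B = oneSiteCoupling β L`), the lower (o5) inequality
`μ₁(B)·λ₀·‖v‖² ≤ e^{CΛ²/L}·⟨v,Kv⟩·μ₀(B)` fails whenever `e^{CΛ²/L}·s²κ₂^{2m}(κ₁−κ₂) > (e^{CΛ²/L} − 1)·κ₁·‖v‖²`, i.e. whenever the dressed leakage
weight times the relative gap exceeds the tolerance: `δ_m(1−r) > 1 − e^{−CΛ²/L}`.  Hence `DynamicCoreClauses 1 C β (fun _ ↦ v)` fails there: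
level universality alone does not give (o5); the channel vector must be concentrated on ONE tower level to `δ_L·Δε ≲ CΛ`. [cite: Luscher1983, §3] -/
theorem not_dynamicCoreClauses_of_dressedMixture (C : ℝ) (h₁ : IsPhys ψ₁) (h₂ : IsPhys ψ₂)
    (he₁ : transferApply β ψ₁ = κ₁ • ψ₁) (he₂ : transferApply β ψ₂ = κ₂ • ψ₂)
    (hn₁ : l2 ψ₁ ψ₁ = 1) (hn₂ : l2 ψ₂ ψ₂ = 1) (h₁₂ : l2 ψ₁ ψ₂ = 0) (s : ℝ) (m : ℕ)
    (hm0 : 0 < levelValue su2Rep 1 (oneSiteCoupling β L) 0)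
    (hlev : levelValue su2Rep 1 (oneSiteCoupling β L) 1 * levelValue su2Rep L β 0 = κ₁ * levelValue su2Rep 1 (oneSiteCoupling β L) 0)
    (hleak : (Real.exp (C * luscherLambda β L ^ 2 / L) - 1) * (κ₁ * (κ₁ ^ (2 * m) + s ^ 2 * κ₂ ^ (2 * m))) <
      Real.exp (C * luscherLambda β L ^ 2 / L) * (s ^ 2 * κ₂ ^ (2 * m) * (κ₁ - κ₂))) :
    ¬ DynamicCoreClauses 1 C β (fun _ => (transferApply (L := L) β)^[m] (ψ₁ + s • ψ₂)) := by
  intro h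
  have h5 := (h.1 0).2
  dsimp only at h5
  simp only [Fin.val_zero, zero_add] at h5
  rw [l2_dressedMixture_self β h₁ h₂ he₁ he₂ hn₁ hn₂ h₁₂, l2_dressedMixture_transferApply β h₁ h₂ he₁ he₂ hn₁ hn₂ h₁₂] at h5
  -- perfect level universality turns the one-site level product into `κ₁·μ₀`; the form number is `κ₁‖v‖²` minus the Ritz deficit
  have hd : κ₁ ^ (2 * m + 1) + s ^ 2 * κ₂ ^ (2 * m + 1) =
      κ₁ * (κ₁ ^ (2 * m) + s ^ 2 * κ₂ ^ (2 * m)) - s ^ 2 * κ₂ ^ (2 * m) * (κ₁ - κ₂) := by ring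
  rw [hlev, hd] at h5
  have h8 := mul_lt_mul_of_pos_left hleak hm0
  nlinarith [h5, h8]

end TwoLevel

/-! ## §4 The log-convexity floor of (o4) -/

section Floor

variable {L : ℕ} [NeZero L] (β : ℝ)

/-- ★ **The leakage defect is non-negative**: `0 ≤ ‖K_βu‖²‖u‖² − ⟨u,K_βu⟩²` for every physical `u` (Cauchy–Schwarz). [folklore] -/
theorem leakage_defect_nonneg {u : GaugeConfig 3 L SU2 → ℝ} (hu : IsPhys u) :
    0 ≤ l2 (transferApply β u) (transferApply β u) * l2 u u - l2 u (transferApply β u) ^ 2 := by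
  have hcs := sq_l2_le hu (isPhys_transferApply (L := L) β hu)
  linarith

/-- `C < 0` is impossible in (o4) on a non-null channel: if `Λ(β,L) > 0`, `λ₀ > 0` and `‖u_i‖² > 0` for some `i`, then
`¬ LeakageClause k C β u` for every `C < 0`. [folklore] -/
theorem not_leakageClause_of_neg {k : ℕ} {C : ℝ} (hC : C < 0) {u : Fin k → (GaugeConfig 3 L SU2 → ℝ)} (hu : ∀ i, IsPhys (u i))
    (hΛ : 0 < luscherLambda β L) (hl0 : 0 < levelValue su2Rep L β 0) {i : Fin k} (hi : 0 < l2 (u i) (u i)) :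
    ¬ LeakageClause k C β u := by
  intro h
  have h0 := h i
  have hfloor := leakage_defect_nonneg β (hu i)
  have hLpos : (0 : ℝ) < L := Nat.cast_pos.mpr (NeZero.pos L)
  have hneg : C * (luscherLambda β L ^ 3 / (L : ℝ) ^ 2) * levelValue su2Rep L β 0 ^ 2 * l2 (u i) (u i) ^ 2 < 0 := by
    have hpos : 0 < (luscherLambda β L ^ 3 / (L : ℝ) ^ 2) * levelValue su2Rep L β 0 ^ 2 * l2 (u i) (u i) ^ 2 :=
      mul_pos (mul_pos (div_pos (pow_pos hΛ 3) (pow_pos hLpos 2)) (pow_pos hl0 2)) (pow_pos hi 2)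
    have : C * ((luscherLambda β L ^ 3 / (L : ℝ) ^ 2) * levelValue su2Rep L β 0 ^ 2 * l2 (u i) (u i) ^ 2) < 0 :=
      mul_neg_of_neg_of_pos hC hpos
    linarith [this]
  linarith

/-- ★ **Log-convexity of the normalised connected correlator at even separation**: for `β > 0`, physical `φ` and a physical insertion family `G`,
`0 ≤ corr_{2m+2,ii}·corr_{2m,ii} − corr_{2m+1,ii}²` — the effective mass `−log(corr_{t+1}/corr_t)` does not increase from `t = 2m` to
`t = 2m+1`; the S-LEAK target `D_{2m} ≤ C(λ³/L²)corr_{2m}²` (`leakageClause_iff_corr`) is one-sided. [cite: LuscherWolff1990] -/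
theorem corr_logConvexity_nonneg {k : ℕ} (hβ : 0 < β) {φ : GaugeConfig 3 L SU2 → ℝ} (hφ : IsPhys φ)
    {G : Fin k → (GaugeConfig 3 L SU2 → ℝ)} (hG : ∀ i, IsPhys (G i)) (m : ℕ) (i : Fin k) :
    0 ≤ corr β φ G (2 * m + 2) i i * corr β φ G (2 * m) i i - corr β φ G (2 * m + 1) i i ^ 2 := by
  have hl0 : 0 < levelValue su2Rep L β 0 := levelValue_su2Rep_pos hβ 0
  have hvP : IsPhys ((transferApply (L := L) β)^[m] (OpPlat.ins φ (G i))) :=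
    isPhys_iterate_transferApply β (OpPlat.isPhys_ins hφ (hG i)) m
  have hfloor := leakage_defect_nonneg β hvP
  rw [corr_dressed_normK hβ hφ hG m i i, corr_dressed_norm hβ hφ hG m i i, corr_dressed_form hβ hφ hG m i i] at hfloor
  have key : levelValue su2Rep L β 0 ^ (2 * m + 2) * corr β φ G (2 * m + 2) i i *
        (levelValue su2Rep L β 0 ^ (2 * m) * corr β φ G (2 * m) i i) -
      (levelValue su2Rep L β 0 ^ (2 * m + 1) * corr β φ G (2 * m + 1) i i) ^ 2 =
      levelValue su2Rep L β 0 ^ (4 * m + 2) *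
        (corr β φ G (2 * m + 2) i i * corr β φ G (2 * m) i i - corr β φ G (2 * m + 1) i i ^ 2) := by
    ring
  rw [key] at hfloor
  exact nonneg_of_mul_nonneg_right hfloor (pow_pos hl0 _)

end Floor

end Summit.QuantumFields.YangMills.Theorems.FemtoTransferGap.PolyakovLift.Negative

end
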